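import Literature.Computability.Cryptography.PhiHidingThreeUnderBQPCollapse
import HarnessLib

/-!
# Every bit of the residues mod `9` of the prime factors of `pq` is PPT under `BQP ⊆ BPP`

Sequel to `PhiHidingThreeUnderBQPCollapse`: the same pipeline — Shor's theorem in `FBQP` form
(`isQSolvable_factoring_holds`), the classical wrap (`isQSolvable_classicalWrap_holds`,
Bernstein–Vazirani 1997 §8), decision from search (`mem_BQP_of_isQSolvable_bit`) and the
pseudo-deterministic simulation of one `BPP` query (`exists_randAlg_adFn`, Arora–Barak 2009
§7.4.1) — is stated once abstractly (`exists_randAlg_of_factorPost`: ANY `FP` post-processing of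
Shor's factor list whose value is a function of the input is PPT-computable under the collapse)
and instantiated on the post-processor reading the residues mod `9` of the TWO least prime
factors (guarded by "the factor list has at least two entries"). Consequences, all folklore
("breaking it is no harder than factoring", Cachin–Micali–Stadler 1999 §2; factoring is in
`FBQP`, Shor 1997 §5): under `BQP ⊆ BPP`

* `exists_randAlg_hondaBit_of_BQP_subset_BPP` — a PPT algorithm decides the "Honda bit"
  `[¬(p ≡ 2,5 ∧ q ≡ 2,5 (mod 9))]` (`= [3 ∣ h(ℚ(∛pq))]` by Honda 1971) of every `N = pq`;
* `exists_randAlg_eisensteinSplit_of_BQP_subset_BPP` — a PPT algorithm decides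
  `[p ≡ q ≡ 8 (mod 9)]` of every `N = pq`;

so each of the three hypothesis-type leaves offered by the quantum-advantage line
`LinnikCubicClassGroups / honda-leak` (Honda-bit hardness, worst-case Φ-hiding for `e = 3`,
Eisenstein-split hardness) implies `BQP ⊄ BPP` BY ITSELF:
`not_BQP_subset_BPP_of_hondaBitHard`, `not_BQP_subset_BPP_of_phiHidingThree`,
`not_BQP_subset_BPP_of_eisensteinSplitHard` (hypotheses verbatim those of the line's transfers).

## References

* C. Cachin, S. Micali, M. Stadler, EUROCRYPT '99, LNCS 1592, §2.
* P. W. Shor, SIAM J. Comput. 26 (1997), §5.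
* E. Bernstein, U. Vazirani, SIAM J. Comput. 26 (1997), §8.
* S. Arora, B. Barak, *Computational Complexity*, CUP 2009, §7.4.1.
* T. Honda, J. Number Theory 3 (1971), 7–12 (the Honda bit).
-/

noncomputable section

namespace Literature.Computability.Cryptography

open _root_.Computability Polynomial
open Literature.Computability.Complexity Literature.Computability.Complexity.Brick
open Literature.Computability.Complexity.AdQuery

/-! ### The abstract pipeline -/

/-- **Any `FP` post-processing of Shor's factor list that is a function of the input is PPT
under `BQP ⊆ BPP`.** If `post ∈ FP` writes `[β z]` on every `⟨z, y⟩` with `y` carrying the code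
of the prime factorisation of `decodeNat z₁` as a prefix, then under `BQP ⊆ BPP` some PPT
`D : {0,1}* → {0,1}` outputs `β ⟨x, ε⟩` with probability `≥ 3/4` on every `x`.
[Shor 1997, §5; Bernstein–Vazirani 1997, §8; Arora–Barak 2009, §7.4.1] [folklore] -/
theorem exists_randAlg_of_factorPost (hsub : BQP ⊆ BPP) {post : List Bool → List Bool}
    (hpost : post ∈ FP) {β : List Bool → Bool}
    (hβ : ∀ z y : List Bool,
      encodingListNatBool.encode (decodeNat (fstF z)).primeFactorsList <+: y →
        post (boolPair z y) = [β z]) :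
    ∃ D : RandAlg (List Bool) Bool, D.IsPolyTime id encodeBool ∧
      ∀ x : List Bool, (3 : ℝ) / 4 ≤ D.pr id x {b | b = β (boolPair x [])} := by
  have hsolv : IsQSolvable fun x =>
      {y | encodingListNatBool.encode (decodeNat x).primeFactorsList <+: y} :=
    isQSolvable_factoring_holds
  have hwrap := isQSolvable_classicalWrap_holds fstF post fstF_mem_FP hpost hsolv
  have hbit : IsQSolvable fun z => {w | [β z] <+: w} := by
    refine hwrap.mono fun z => ?_
    rintro w ⟨y, hy, hw⟩
    rwa [hβ z y hy] at hw
  have hBQP : {z : List Bool | β z = true} ∈ BQP :=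
    mem_BQP_of_isQSolvable_bit (fun _ _ => QCircuit.outputPMF_apply_holds)
      cliffordT_isUnitary_holds (fun z => Iff.rfl) hbit
  obtain ⟨R, hR, -, hpr⟩ :=
    AdBPPSim.exists_randAlg_adFn (hsub hBQP) OracleCompose.id_mem_FP sndF_mem_FP (1 : Polynomial ℕ)
  refine ⟨{ run := fun x r => decide (bitsToNat (R.run x r) % 3 = 1), coinLen := R.coinLen },
    isPolyTime_modThreeEqOne hR, fun x => ?_⟩
  have h := hpr x
  have hind : {z : List Bool | β z = true}.boolIndicator (boolPair x []) = β (boolPair x []) := by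
    cases hb : β (boolPair x [])
    · exact (Set.notMem_iff_boolIndicator _ _).1 fun hs => by
        rw [Set.mem_setOf_eq, hb] at hs
        exact Bool.false_ne_true hs
    · exact (Set.mem_iff_boolIndicator _ _).1 hb
  rw [adFn_one_sndF, hind] at h
  exact h.trans (pr_singleton_le_pr_modThreeEqOne R x _)

/-! ### The code of the factor list: one and at least two entries -/

/-- The list code of a singleton, followed by `w`: `⟨1, ⟨encodeNat p, w⟩⟩`. [folklore] -/
theorem encode_singleton_append (p : ℕ) (w : List Bool) :
    encodingListNatBool.encode [p] ++ w = boolPair [true] (boolPair (encodeNat p) w) := by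
  rw [encode_cons_append]
  rfl

/-- The list code of a list with at least two entries, followed by `w`:
`⟨1^{|L|+2}, ⟨encodeNat p₁, ⟨encodeNat p₂, …⟩⟩⟩`. [folklore] -/
theorem encode_cons_cons_append (p₁ p₂ : ℕ) (L : List ℕ) (w : List Bool) :
    encodingListNatBool.encode (p₁ :: p₂ :: L) ++ w =
      boolPair (true :: true :: unaryEncodeNat L.length)
        (boolPair (encodeNat p₁) (boolPair (encodeNat p₂)
          (L.foldr (fun a acc => boolPair (encodeNat a) acc) [] ++ w))) := by
  rw [encode_cons_append, List.foldr_cons, boolPair_append]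
  rfl

/-- The prime factorisation list of a product of two distinct primes is `[p, q]` or `[q, p]`.
[folklore] -/
theorem primeFactorsList_mul_of_prime {p q : ℕ} (hp : p.Prime) (hq : q.Prime) :
    (p * q).primeFactorsList = [p, q] ∨ (p * q).primeFactorsList = [q, p] := by
  obtain ⟨k, hk⟩ : ∃ k, p * q = k + 2 :=
    ⟨p * q - 2, by have := Nat.mul_le_mul hp.two_le hq.two_le; omega⟩
  have hunf : (p * q).primeFactorsList =
      (p * q).minFac :: ((p * q) / (p * q).minFac).primeFactorsList := by
    rw [hk, Nat.primeFactorsList_add_two]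
  rcases minFac_mul_eq_or hp hq with h | h
  · left
    rw [hunf, h, Nat.mul_div_cancel_left q hp.pos, Nat.primeFactorsList_prime hq]
  · right
    rw [hunf, h, Nat.mul_div_cancel p hq.pos, Nat.primeFactorsList_prime hp]

/-! ### The post-processor reading the residues mod `9` of the two least prime factors -/

/-- Pointwise value of the guarded two-residue post-processor with table `F` realised by bricks:
on `⟨z, y⟩` it writes `[2 < ⟦y₁⟧ && T]`, where `T` is the Boolean in the statement, a function of
`a = ⟦(y₂)₁⟧ mod 9` and `b = ⟦(y₃)₁⟧ mod 9` (`y₂ = sndF y`, `y₃ = sndF (sndF y)`). Here for the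
Honda table `¬((a ∈ {2,5}) ∧ (b ∈ {2,5}))`. [folklore] -/
theorem hondaPost_apply (z y : List Bool) :
    (andFn (ltFn ∘ fanoutFn (fun _ => encodeNat 2) (fstF ∘ sndF))
      (notFn (andFn
        (Brick.orFn
          (eqValFn ∘ fanoutFn (remFn ∘ fanoutFn (fstF ∘ sndF ∘ sndF) (fun _ => encodeNat 9))
            (fun _ => encodeNat 2))
          (eqValFn ∘ fanoutFn (remFn ∘ fanoutFn (fstF ∘ sndF ∘ sndF) (fun _ => encodeNat 9))
            (fun _ => encodeNat 5)))
        (Brick.orFn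
          (eqValFn ∘ fanoutFn (remFn ∘ fanoutFn (fstF ∘ sndF ∘ sndF ∘ sndF)
            (fun _ => encodeNat 9)) (fun _ => encodeNat 2))
          (eqValFn ∘ fanoutFn (remFn ∘ fanoutFn (fstF ∘ sndF ∘ sndF ∘ sndF)
            (fun _ => encodeNat 9)) (fun _ => encodeNat 5))))))
        (boolPair z y) =
      [decide (2 < bitsToNat (fstF y)) &&
        !((decide (bitsToNat (fstF (sndF y)) % 9 = 2) ||
            decide (bitsToNat (fstF (sndF y)) % 9 = 5)) &&
          (decide (bitsToNat (fstF (sndF (sndF y))) % 9 = 2) ||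
            decide (bitsToNat (fstF (sndF (sndF y))) % 9 = 5)))] := by
  refine andFn_apply (by simp [Function.comp]) (notFn_apply (andFn_apply
    (orFn_apply (by simp [Function.comp]) (by simp [Function.comp]))
    (orFn_apply (by simp [Function.comp]) (by simp [Function.comp]))))

/-- The guarded Honda post-processor is in `FP` (brick algebra). [folklore] -/
theorem hondaPost_mem_FP :
    (andFn (ltFn ∘ fanoutFn (fun _ => encodeNat 2) (fstF ∘ sndF))
      (notFn (andFn
        (Brick.orFn
          (eqValFn ∘ fanoutFn (remFn ∘ fanoutFn (fstF ∘ sndF ∘ sndF) (fun _ => encodeNat 9))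
            (fun _ => encodeNat 2))
          (eqValFn ∘ fanoutFn (remFn ∘ fanoutFn (fstF ∘ sndF ∘ sndF) (fun _ => encodeNat 9))
            (fun _ => encodeNat 5)))
        (Brick.orFn
          (eqValFn ∘ fanoutFn (remFn ∘ fanoutFn (fstF ∘ sndF ∘ sndF ∘ sndF)
            (fun _ => encodeNat 9)) (fun _ => encodeNat 2))
          (eqValFn ∘ fanoutFn (remFn ∘ fanoutFn (fstF ∘ sndF ∘ sndF ∘ sndF)
            (fun _ => encodeNat 9)) (fun _ => encodeNat 5)))))) ∈ FP := by
  have hA : (remFn ∘ fanoutFn (fstF ∘ sndF ∘ sndF) (fun _ => encodeNat 9)) ∈ FP :=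
    comp_mem_FP remFn_mem_FP (fanoutFn_mem_FP
      (comp_mem_FP fstF_mem_FP (comp_mem_FP sndF_mem_FP sndF_mem_FP)) (const_mem_FP _))
  have hB : (remFn ∘ fanoutFn (fstF ∘ sndF ∘ sndF ∘ sndF) (fun _ => encodeNat 9)) ∈ FP :=
    comp_mem_FP remFn_mem_FP (fanoutFn_mem_FP
      (comp_mem_FP fstF_mem_FP (comp_mem_FP sndF_mem_FP (comp_mem_FP sndF_mem_FP sndF_mem_FP)))
      (const_mem_FP _))
  have hE : ∀ {g : List Bool → List Bool}, g ∈ FP → ∀ k : ℕ,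
      (eqValFn ∘ fanoutFn g (fun _ => encodeNat k)) ∈ FP := fun hg k =>
    comp_mem_FP eqValFn_mem_FP (fanoutFn_mem_FP hg (const_mem_FP _))
  exact andFn_mem_FP
    (comp_mem_FP ltFn_mem_FP (fanoutFn_mem_FP (const_mem_FP _)
      (comp_mem_FP fstF_mem_FP sndF_mem_FP)))
    (notFn_mem_FP (andFn_mem_FP (orFn_mem_FP (hE hA 2) (hE hA 5)) (orFn_mem_FP (hE hB 2) (hE hB 5))))

/-- On a measured string carrying the factor list `l` of `N = decodeNat z₁` as a prefix, the
guarded Honda post-processor writes the bit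
`[2 ≤ |l| ∧ ¬((l₀ ≡ 2,5 (mod 9)) ∧ (l₁ ≡ 2,5 (mod 9)))]` — a function of `z`. [folklore] -/
theorem hondaPost_of_prefix (z y : List Bool)
    (hy : encodingListNatBool.encode (decodeNat (fstF z)).primeFactorsList <+: y) :
    (andFn (ltFn ∘ fanoutFn (fun _ => encodeNat 2) (fstF ∘ sndF))
      (notFn (andFn
        (Brick.orFn
          (eqValFn ∘ fanoutFn (remFn ∘ fanoutFn (fstF ∘ sndF ∘ sndF) (fun _ => encodeNat 9))
            (fun _ => encodeNat 2))
          (eqValFn ∘ fanoutFn (remFn ∘ fanoutFn (fstF ∘ sndF ∘ sndF) (fun _ => encodeNat 9))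
            (fun _ => encodeNat 5)))
        (Brick.orFn
          (eqValFn ∘ fanoutFn (remFn ∘ fanoutFn (fstF ∘ sndF ∘ sndF ∘ sndF)
            (fun _ => encodeNat 9)) (fun _ => encodeNat 2))
          (eqValFn ∘ fanoutFn (remFn ∘ fanoutFn (fstF ∘ sndF ∘ sndF ∘ sndF)
            (fun _ => encodeNat 9)) (fun _ => encodeNat 5))))))
        (boolPair z y) =
      [decide (2 ≤ (decodeNat (fstF z)).primeFactorsList.length ∧
        ¬ ((((decodeNat (fstF z)).primeFactorsList.getD 0 0) % 9 = 2 ∨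
              ((decodeNat (fstF z)).primeFactorsList.getD 0 0) % 9 = 5) ∧
            (((decodeNat (fstF z)).primeFactorsList.getD 1 0) % 9 = 2 ∨
              ((decodeNat (fstF z)).primeFactorsList.getD 1 0) % 9 = 5)))] := by
  obtain ⟨t, rfl⟩ := hy
  rw [hondaPost_apply]
  rcases hl : (decodeNat (fstF z)).primeFactorsList with _ | ⟨p₁, _ | ⟨p₂, L⟩⟩
  · rw [encode_nil_append]
    simp
  · rw [encode_singleton_append]
    simp
  · rw [encode_cons_cons_append]
    simp only [fstF_boolPair, sndF_boolPair, bitsToNat_cons, bitsToNat_encodeNat,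
      List.length_cons, List.getD_cons_zero, List.getD_cons_succ]
    have hg : decide (2 < Bool.toNat true + 2 * (Bool.toNat true +
        2 * bitsToNat (unaryEncodeNat L.length))) = true := by
      simp only [Bool.toNat_true, decide_eq_true_eq]; omega
    rw [hg, Bool.true_and]
    have h2 : (2 ≤ L.length + 1 + 1) = True := by simp
    simp only [h2, true_and, decide_not, Bool.decide_and, Bool.decide_or]

/-! ### The same for the Eisenstein-split table `a = 8 ∧ b = 8` -/

/-- Pointwise value of the guarded Eisenstein-split post-processor: `[2 < ⟦y₁⟧ && (a = 8 && b = 8)]`.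
[folklore] -/
theorem eisPost_apply (z y : List Bool) :
    (andFn (ltFn ∘ fanoutFn (fun _ => encodeNat 2) (fstF ∘ sndF))
      (andFn
        (eqValFn ∘ fanoutFn (remFn ∘ fanoutFn (fstF ∘ sndF ∘ sndF) (fun _ => encodeNat 9))
          (fun _ => encodeNat 8))
        (eqValFn ∘ fanoutFn (remFn ∘ fanoutFn (fstF ∘ sndF ∘ sndF ∘ sndF)
          (fun _ => encodeNat 9)) (fun _ => encodeNat 8))))
        (boolPair z y) =
      [decide (2 < bitsToNat (fstF y)) &&
        (decide (bitsToNat (fstF (sndF y)) % 9 = 8) &&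
          decide (bitsToNat (fstF (sndF (sndF y))) % 9 = 8))] :=
  andFn_apply (by simp [Function.comp])
    (andFn_apply (by simp [Function.comp]) (by simp [Function.comp]))

/-- The guarded Eisenstein-split post-processor is in `FP`. [folklore] -/
theorem eisPost_mem_FP :
    (andFn (ltFn ∘ fanoutFn (fun _ => encodeNat 2) (fstF ∘ sndF))
      (andFn
        (eqValFn ∘ fanoutFn (remFn ∘ fanoutFn (fstF ∘ sndF ∘ sndF) (fun _ => encodeNat 9))
          (fun _ => encodeNat 8))
        (eqValFn ∘ fanoutFn (remFn ∘ fanoutFn (fstF ∘ sndF ∘ sndF ∘ sndF)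
          (fun _ => encodeNat 9)) (fun _ => encodeNat 8)))) ∈ FP :=
  andFn_mem_FP
    (comp_mem_FP ltFn_mem_FP (fanoutFn_mem_FP (const_mem_FP _)
      (comp_mem_FP fstF_mem_FP sndF_mem_FP)))
    (andFn_mem_FP
      (comp_mem_FP eqValFn_mem_FP (fanoutFn_mem_FP
        (comp_mem_FP remFn_mem_FP (fanoutFn_mem_FP
          (comp_mem_FP fstF_mem_FP (comp_mem_FP sndF_mem_FP sndF_mem_FP)) (const_mem_FP _)))
        (const_mem_FP _)))
      (comp_mem_FP eqValFn_mem_FP (fanoutFn_mem_FP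
        (comp_mem_FP remFn_mem_FP (fanoutFn_mem_FP
          (comp_mem_FP fstF_mem_FP (comp_mem_FP sndF_mem_FP (comp_mem_FP sndF_mem_FP sndF_mem_FP)))
          (const_mem_FP _)))
        (const_mem_FP _))))

/-- On a measured string carrying the factor list `l` of `N = decodeNat z₁` as a prefix, the
guarded Eisenstein-split post-processor writes `[2 ≤ |l| ∧ l₀ ≡ 8 ∧ l₁ ≡ 8 (mod 9)]`. [folklore] -/
theorem eisPost_of_prefix (z y : List Bool)
    (hy : encodingListNatBool.encode (decodeNat (fstF z)).primeFactorsList <+: y) :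
    (andFn (ltFn ∘ fanoutFn (fun _ => encodeNat 2) (fstF ∘ sndF))
      (andFn
        (eqValFn ∘ fanoutFn (remFn ∘ fanoutFn (fstF ∘ sndF ∘ sndF) (fun _ => encodeNat 9))
          (fun _ => encodeNat 8))
        (eqValFn ∘ fanoutFn (remFn ∘ fanoutFn (fstF ∘ sndF ∘ sndF ∘ sndF)
          (fun _ => encodeNat 9)) (fun _ => encodeNat 8))))
        (boolPair z y) =
      [decide (2 ≤ (decodeNat (fstF z)).primeFactorsList.length ∧
        ((decodeNat (fstF z)).primeFactorsList.getD 0 0) % 9 = 8 ∧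
          ((decodeNat (fstF z)).primeFactorsList.getD 1 0) % 9 = 8)] := by
  obtain ⟨t, rfl⟩ := hy
  rw [eisPost_apply]
  rcases hl : (decodeNat (fstF z)).primeFactorsList with _ | ⟨p₁, _ | ⟨p₂, L⟩⟩
  · rw [encode_nil_append]
    simp
  · rw [encode_singleton_append]
    simp
  · rw [encode_cons_cons_append]
    simp only [fstF_boolPair, sndF_boolPair, bitsToNat_cons, bitsToNat_encodeNat,
      List.length_cons, List.getD_cons_zero, List.getD_cons_succ]
    have hg : decide (2 < Bool.toNat true + 2 * (Bool.toNat true +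
        2 * bitsToNat (unaryEncodeNat L.length))) = true := by
      simp only [Bool.toNat_true, decide_eq_true_eq]; omega
    rw [hg, Bool.true_and]
    have h2 : (2 ≤ L.length + 1 + 1) = True := by simp
    simp only [h2, true_and, Bool.decide_and]

/-! ### The Honda bit and the Eisenstein-split bit of `pq` under the collapse -/

/-- **Under `BQP ⊆ BPP` the Honda bit is PPT**: some PPT `D` outputs
`[¬(p ≡ 2,5 ∧ q ≡ 2,5 (mod 9))]` with probability `≥ 3/4` on the binary encoding of every product
`pq` of two distinct primes. [Shor 1997, §5; Cachin–Micali–Stadler 1999, §2] [folklore] -/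
theorem exists_randAlg_hondaBit_of_BQP_subset_BPP (hsub : BQP ⊆ BPP) :
    ∃ D : RandAlg (List Bool) Bool, D.IsPolyTime id encodeBool ∧
      ∀ p q : ℕ, p.Prime → q.Prime → p ≠ q →
        (3 : ℝ) / 4 ≤ D.pr id (encodeNat (p * q))
          {b | b = decide (¬ ((p % 9 = 2 ∨ p % 9 = 5) ∧ (q % 9 = 2 ∨ q % 9 = 5)))} := by
  obtain ⟨D, hD, hpr⟩ := exists_randAlg_of_factorPost hsub hondaPost_mem_FP hondaPost_of_prefix
  refine ⟨D, hD, fun p q hp hq hpq => ?_⟩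
  have h := hpr (encodeNat (p * q))
  have key : decide (2 ≤ (decodeNat (fstF (boolPair (encodeNat (p * q)) []))).primeFactorsList.length ∧
      ¬ ((((decodeNat (fstF (boolPair (encodeNat (p * q)) []))).primeFactorsList.getD 0 0) % 9 = 2 ∨
            ((decodeNat (fstF (boolPair (encodeNat (p * q)) []))).primeFactorsList.getD 0 0) % 9 = 5) ∧
          (((decodeNat (fstF (boolPair (encodeNat (p * q)) []))).primeFactorsList.getD 1 0) % 9 = 2 ∨
            ((decodeNat (fstF (boolPair (encodeNat (p * q)) []))).primeFactorsList.getD 1 0) % 9 = 5))) =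
      decide (¬ ((p % 9 = 2 ∨ p % 9 = 5) ∧ (q % 9 = 2 ∨ q % 9 = 5))) := by
    rw [fstF_boolPair, decode_encodeNat]
    rcases primeFactorsList_mul_of_prime hp hq with hl | hl <;>
      · rw [hl]; exact decide_eq_decide.mpr (by simp only [List.length_cons, List.length_nil,
          List.getD_cons_zero, List.getD_cons_succ]; tauto)
  rw [key] at h
  exact h

/-- **Under `BQP ⊆ BPP` the Eisenstein-split bit is PPT**: some PPT `D` outputs
`[p ≡ q ≡ 8 (mod 9)]` with probability `≥ 3/4` on the binary encoding of every product `pq` of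
two distinct primes. [Shor 1997, §5] [folklore] -/
theorem exists_randAlg_eisensteinSplit_of_BQP_subset_BPP (hsub : BQP ⊆ BPP) :
    ∃ D : RandAlg (List Bool) Bool, D.IsPolyTime id encodeBool ∧
      ∀ p q : ℕ, p.Prime → q.Prime → p ≠ q →
        (3 : ℝ) / 4 ≤ D.pr id (encodeNat (p * q)) {b | b = decide (p % 9 = 8 ∧ q % 9 = 8)} := by
  obtain ⟨D, hD, hpr⟩ := exists_randAlg_of_factorPost hsub eisPost_mem_FP eisPost_of_prefix
  refine ⟨D, hD, fun p q hp hq hpq => ?_⟩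
  have h := hpr (encodeNat (p * q))
  have key : decide (2 ≤ (decodeNat (fstF (boolPair (encodeNat (p * q)) []))).primeFactorsList.length ∧
      ((decodeNat (fstF (boolPair (encodeNat (p * q)) []))).primeFactorsList.getD 0 0) % 9 = 8 ∧
        ((decodeNat (fstF (boolPair (encodeNat (p * q)) []))).primeFactorsList.getD 1 0) % 9 = 8) =
      decide (p % 9 = 8 ∧ q % 9 = 8) := by
    rw [fstF_boolPair, decode_encodeNat]
    rcases primeFactorsList_mul_of_prime hp hq with hl | hl <;>
      · rw [hl]; exact decide_eq_decide.mpr (by simp only [List.length_cons, List.length_nil,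
          List.getD_cons_zero, List.getD_cons_succ]; tauto)
  rw [key] at h
  exact h

/-! ### Each leaf of the honda-leak line implies `BQP ⊄ BPP` by itself -/

/-- **Honda-bit hardness implies `BQP ⊄ BPP`.** The hypothesis `hB` is verbatim the hardness
hypothesis of the quantum-advantage transfer `pureCubicClassNumberHard_of_honda_of_hondaBitHard`
(line `LinnikCubicClassGroups / honda-leak`); it already yields the summit statement
`∃ L ∈ BQP, L ∉ BPP` without any class-number input. [folklore] -/
theorem not_BQP_subset_BPP_of_hondaBitHard
    (hB : ¬ ∃ D : RandAlg (List Bool) Bool, D.IsPolyTime id encodeBool ∧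
      ∀ p q : ℕ, p.Prime → q.Prime → p ≠ q → ((p * q) % 9 = 1 ∨ (p * q) % 9 = 8) →
        (2 : ℝ) / 3 ≤ D.pr id (encodeNat (p * q))
          {b | b = decide (¬ ((p % 9 = 2 ∨ p % 9 = 5) ∧ (q % 9 = 2 ∨ q % 9 = 5)))}) :
    ¬ (BQP ⊆ BPP) := fun hsub => by
  obtain ⟨D, hD, hpr⟩ := exists_randAlg_hondaBit_of_BQP_subset_BPP hsub
  exact hB ⟨D, hD, fun p q hp hq hpq _ => by linarith [hpr p q hp hq hpq]⟩

/-- **Worst-case Φ-hiding for `e = 3` on the pure-cubic promise family implies `BQP ⊄ BPP`.** The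
hypothesis is verbatim that of `pureCubicClassNumberHard_of_honda_of_phiHiding3` /
`pureCubicClassNumberHard_of_phiHiding3` (the line's registered stub `stub_phiHiding3`).
[Cachin–Micali–Stadler 1999, §2] [folklore] -/
theorem not_BQP_subset_BPP_of_phiHidingThree
    (hΦ : ¬ ∃ D : RandAlg (List Bool) Bool, D.IsPolyTime id encodeBool ∧
      ∀ p q : ℕ, p.Prime → q.Prime → p ≠ q → (p * q) % 9 = 1 →
        ((p % 3 = 1 ∧ q % 3 = 1) ∨ (p % 9 = 2 ∧ q % 9 = 5) ∨ (p % 9 = 5 ∧ q % 9 = 2)) →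
        (2 : ℝ) / 3 ≤ D.pr id (encodeNat (p * q)) {b | b = decide (p % 3 = 1)}) :
    ¬ (BQP ⊆ BPP) :=
  fun hsub => hΦ (exists_randAlg_phiHidingThree_of_BQP_subset_BPP hsub)

/-- **Eisenstein-split hardness implies `BQP ⊄ BPP`.** The hypothesis is verbatim that of
`pureCubicClassNumberHard_of_honda_of_eisensteinSplitHard`. [folklore] -/
theorem not_BQP_subset_BPP_of_eisensteinSplitHard
    (hS : ¬ ∃ D : RandAlg (List Bool) Bool, D.IsPolyTime id encodeBool ∧
      ∀ p q : ℕ, p.Prime → q.Prime → p ≠ q → p % 3 = 2 → q % 3 = 2 → (p * q) % 9 = 1 →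
        (2 : ℝ) / 3 ≤ D.pr id (encodeNat (p * q)) {b | b = decide (p % 9 = 8 ∧ q % 9 = 8)}) :
    ¬ (BQP ⊆ BPP) := fun hsub => by
  obtain ⟨D, hD, hpr⟩ := exists_randAlg_eisensteinSplit_of_BQP_subset_BPP hsub
  exact hS ⟨D, hD, fun p q hp hq hpq _ _ _ => by linarith [hpr p q hp hq hpq]⟩

end Literature.Computability.Cryptography
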